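import Literature.MathematicalPhysics.QuantumLattice.WilsonLoops
import HarnessLib

/-!
# Wilson loops on `ℤ^d`: proofs (cylinder property, continuity, passage to limit points)

Trunk T-QLATTICE, companion of `Literature.MathematicalPhysics.QuantumLattice.WilsonLoops`
(which states the notions and the named fact `hasAreaLawState_of_hasAreaLaw`); this file only
PROVES — it declares no definition.

## Contents

* `walkHolonomy_congr`, `isCylinder_wilsonLoopObs`: the Wilson loop observable `W_w = χ(hol_w)`
  of a closed lattice walk `w` is a cylinder observable supported on the (positively oriented)
  edges under the darts of `w`;
* `continuous_dartHolonomy`, `continuous_walkHolonomy`, `continuous_wilsonLoopObs`: continuity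
  in the product topology of `LGConfig d G = (edges → G)` for a topological group `G` and a
  continuous class function `χ`; `exists_abs_wilsonLoopObs_le`: boundedness for compact `G`;
* `toTorusObservable_wilsonLoopObs_rectWalk`: the torus restriction (through the periodic lift)
  of the rectangular Wilson loop observable for `χ = normalisedCharacter N ∘ ρ` **is** Wave 0's
  torus Wilson loop `ConstructiveQFT.wilsonLoop ρ (proj x) i j R T` (from the tree's
  `walkHolonomy_rectWalk_eq`);
* **passage to infinite-volume limit points**: for `μ ∈ infiniteVolumeLimitPoints ρ β` (limit of
  the torus Wilson states along tori `Λ_{L_k+1}` on bounded continuous cylinder observables),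
  an eventual (in the torus size `L`) lower bound `a ≤ ⟨W_{R×T}⟩_{Λ_{L+1},β}` gives
  `a ≤ W_μ(R,T)` (`le_rectExpectation_of_eventually`), an eventual upper bound
  `|⟨W_{R×T}⟩_{Λ_{L+1},β}| ≤ b` gives `|W_μ(R,T)| ≤ b` (`abs_rectExpectation_le_of_eventually`);
  hence a torus perimeter law valid for all large tori passes to every limit point
  (`hasPerimeterLaw_of_eventually`), and the **discharge**
  `hasAreaLawState_of_hasAreaLaw_holds` of the named fact `hasAreaLawState_of_hasAreaLaw`
  (Wave 0's volume-uniform torus area law `ConstructiveQFT.HasAreaLaw d ρ β` passes to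
  `HasAreaLawState μ (normalisedCharacter N ∘ ρ)` for every limit point `μ`).

## Sources

E. Seiler, *Gauge Theories as a Problem of Constructive Quantum Field Theory and Statistical
Mechanics*, LNP 159 (1982), §2 (Wilson loops, thermodynamic limit of loop expectations);
S. Chatterjee, *Yang–Mills for probabilists*, arXiv:1803.01950, §2 (infinite-volume limits as
weak limits on local observables), §4 (area law). The arguments here are elementary
bookkeeping (closedness of `≤` under limits). [folklore]
-/

noncomputable section

open MeasureTheory Filter Topology SimpleGraph
open Literature.Probability.LatticeModels Literature.MathematicalPhysics.QuantumLattice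

namespace Literature.MathematicalPhysics.QuantumLattice

variable {d : ℕ} {G : Type*} [Group G]

/-! ### The Wilson loop observable is a cylinder observable -/

/-- The dart holonomy only sees the configuration on the edge under the dart. [folklore] -/
theorem dartHolonomy_congr {U V : LGConfig d G} (e : (zdGraph d).Dart)
    (h : U (dartStep e).1 = V (dartStep e).1) : dartHolonomy U e = dartHolonomy V e := by
  simp only [dartHolonomy, h]

/-- The holonomy of a walk only sees the configuration on the edges under its darts. [folklore] -/
theorem walkHolonomy_congr {x y : Site d} {U V : LGConfig d G} (w : (zdGraph d).Walk x y)
    (h : ∀ e ∈ w.darts, U (dartStep e).1 = V (dartStep e).1) :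
    walkHolonomy U w = walkHolonomy V w := by
  unfold walkHolonomy
  rw [List.map_congr_left fun e he => dartHolonomy_congr e (h e he)]

/-- The Wilson loop observable of a closed walk `w` is a cylinder observable, supported on the
finite set of edges under the darts of `w` (Seiler LNP 159 §2: Wilson loops are local
observables). [folklore] -/
theorem isCylinder_wilsonLoopObs {x : Site d} (χ : G → ℝ) (w : (zdGraph d).Walk x x) :
    IsCylinder (wilsonLoopObs χ w) (w.darts.map fun e => (dartStep e).1).toFinset := by
  intro U V hUV
  have key : ∀ e ∈ w.darts, U (dartStep e).1 = V (dartStep e).1 := fun e he =>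
    hUV _ (by rw [List.coe_toFinset, Set.mem_setOf_eq, List.mem_map]; exact ⟨e, he, rfl⟩)
  simp only [wilsonLoopObs]
  rw [walkHolonomy_congr w key]

/-! ### Continuity and boundedness -/

section Continuity

variable [TopologicalSpace G] [IsTopologicalGroup G]

/-- The dart holonomy `U ↦ U_e^{±1}` is continuous in the product topology. [folklore] -/
theorem continuous_dartHolonomy (e : (zdGraph d).Dart) :
    Continuous fun U : LGConfig d G => dartHolonomy U e := by
  by_cases hb : (dartStep e).2 = true
  · have h : (fun U : LGConfig d G => dartHolonomy U e) = fun U => U (dartStep e).1 := by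
      funext U; simp [dartHolonomy, hb]
    rw [h]
    exact continuous_apply _
  · have h : (fun U : LGConfig d G => dartHolonomy U e) = fun U => (U (dartStep e).1)⁻¹ := by
      funext U; simp [dartHolonomy, hb]
    rw [h]
    exact (continuous_apply _).inv

/-- The holonomy of a walk is continuous in the configuration (a finite ordered product of
continuous maps into the topological group `G`). [folklore] -/
theorem continuous_walkHolonomy {x y : Site d} (w : (zdGraph d).Walk x y) :
    Continuous fun U : LGConfig d G => walkHolonomy U w :=
  continuous_list_prod w.darts fun e _ => continuous_dartHolonomy e

/-- The Wilson loop observable of a continuous class function is continuous. [folklore] -/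
theorem continuous_wilsonLoopObs {x : Site d} {χ : G → ℝ} (hχ : Continuous χ)
    (w : (zdGraph d).Walk x x) : Continuous (wilsonLoopObs χ w) :=
  hχ.comp (continuous_walkHolonomy w)

omit [IsTopologicalGroup G] in
/-- For compact `G` and continuous `χ`, the Wilson loop observable is bounded. [folklore] -/
theorem exists_abs_wilsonLoopObs_le [CompactSpace G] {x : Site d} {χ : G → ℝ} (hχ : Continuous χ)
    (w : (zdGraph d).Walk x x) : ∃ C, ∀ U : LGConfig d G, |wilsonLoopObs χ w U| ≤ C := by
  obtain ⟨C, hC⟩ := isCompact_univ.exists_bound_of_continuousOn hχ.continuousOn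
  exact ⟨C, fun U => by simpa [Real.norm_eq_abs, wilsonLoopObs] using hC (walkHolonomy U w) (Set.mem_univ _)⟩

omit [IsTopologicalGroup G] in
/-- `normalisedCharacter N ∘ ρ` is continuous for a continuous matrix representation `ρ`. [folklore] -/
theorem continuous_normalisedCharacter_comp {N : ℕ} {ρ : G →* Matrix (Fin N) (Fin N) ℂ}
    (hρ : Continuous ρ) : Continuous fun g => normalisedCharacter N (ρ g) := by
  unfold normalisedCharacter
  fun_prop

end Continuity

/-! ### The torus restriction of the rectangular Wilson loop observable -/

/-- Through the periodic lift, the rectangular Wilson loop observable for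
`χ = normalisedCharacter N ∘ ρ` restricts to Wave 0's torus Wilson loop `W_{R×T}` based at the
projected base point (the tree's `walkHolonomy_rectWalk_eq`). [folklore] -/
theorem toTorusObservable_wilsonLoopObs_rectWalk {N : ℕ} (ρ : G →* Matrix (Fin N) (Fin N) ℂ)
    (L : ℕ) (x : Site d) (i j : Fin d) (R T : ℕ) :
    toTorusObservable L (wilsonLoopObs (fun g => normalisedCharacter N (ρ g)) (rectWalk x i j R T))
      = QuantumFieldTheory.wilsonLoop ρ (Torus.proj L x) i j R T := by
  funext U
  simp only [toTorusObservable_apply, wilsonLoopObs, walkHolonomy_rectWalk_eq,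
    QuantumFieldTheory.wilsonLoop, normalisedCharacter]

/-! ### Passage to infinite-volume limit points -/

section Limits

variable {N : ℕ} [TopologicalSpace G] [IsTopologicalGroup G] [CompactSpace G]
  [MeasurableSpace G] [BorelSpace G] (ρ : G →* Matrix (Fin N) (Fin N) ℂ)

/-- The rectangular loop expectation of a limit point is the limit of the torus loop
expectations along the defining subsequence of tori. [folklore] -/
theorem tendsto_wilsonExpectation_wilsonLoop [NeZero d] (hρ : Continuous ρ) {β : ℝ}
    {μ : Measure (LGConfig d G)} {Ls : ℕ → ℕ} (hμ : IsInfiniteVolumeLimitAlong ρ β Ls μ)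
    (R T : ℕ) :
    Tendsto (fun k : ℕ => QuantumFieldTheory.wilsonExpectation (L := Ls k + 1) ρ β
        (QuantumFieldTheory.wilsonLoop ρ (0 : QuantumFieldTheory.Site d (Ls k + 1)) 0 1 R T))
      atTop (𝓝 (rectExpectation μ (fun g => normalisedCharacter N (ρ g)) 0 1 R T)) := by
  have hχ := continuous_normalisedCharacter_comp (N := N) hρ
  have h := hμ.2 (wilsonLoopObs (fun g => normalisedCharacter N (ρ g)) (rectWalk (0 : Site d) 0 1 R T))
    _ (isCylinder_wilsonLoopObs _ _) (continuous_wilsonLoopObs hχ _)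
    (exists_abs_wilsonLoopObs_le hχ _)
  have h0 : ∀ L : ℕ, Torus.proj L (0 : Site d) = 0 := fun L => by funext i; simp [Torus.proj]
  simp only [toTorusObservable_wilsonLoopObs_rectWalk, h0] at h
  exact h

/-- **Eventual torus lower bounds pass to limit points.** If `a ≤ ⟨W_{R×T}⟩_{Λ_{L+1},β}` for all
large `L`, then `a ≤ W_μ(R,T)` for every `μ ∈ infiniteVolumeLimitPoints ρ β`. [folklore] -/
theorem le_rectExpectation_of_eventually [NeZero d] (hρ : Continuous ρ) {β : ℝ}
    {μ : Measure (LGConfig d G)} (hμ : μ ∈ infiniteVolumeLimitPoints ρ β) {R T : ℕ} {a : ℝ}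
    (h : ∀ᶠ L : ℕ in atTop, a ≤ QuantumFieldTheory.wilsonExpectation (L := L + 1) ρ β
        (QuantumFieldTheory.wilsonLoop ρ (0 : QuantumFieldTheory.Site d (L + 1)) 0 1 R T)) :
    a ≤ rectExpectation μ (fun g => normalisedCharacter N (ρ g)) 0 1 R T := by
  obtain ⟨Ls, hLs, hlim⟩ := hμ
  exact ge_of_tendsto (tendsto_wilsonExpectation_wilsonLoop ρ hρ hlim R T)
    (hLs.tendsto_atTop.eventually h)

/-- **Eventual torus upper bounds pass to limit points.** If `|⟨W_{R×T}⟩_{Λ_{L+1},β}| ≤ b` for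
all large `L`, then `|W_μ(R,T)| ≤ b` for every `μ ∈ infiniteVolumeLimitPoints ρ β`. [folklore] -/
theorem abs_rectExpectation_le_of_eventually [NeZero d] (hρ : Continuous ρ) {β : ℝ}
    {μ : Measure (LGConfig d G)} (hμ : μ ∈ infiniteVolumeLimitPoints ρ β) {R T : ℕ} {b : ℝ}
    (h : ∀ᶠ L : ℕ in atTop, |QuantumFieldTheory.wilsonExpectation (L := L + 1) ρ β
        (QuantumFieldTheory.wilsonLoop ρ (0 : QuantumFieldTheory.Site d (L + 1)) 0 1 R T)| ≤ b) :
    |rectExpectation μ (fun g => normalisedCharacter N (ρ g)) 0 1 R T| ≤ b := by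
  obtain ⟨Ls, hLs, hlim⟩ := hμ
  exact le_of_tendsto (tendsto_wilsonExpectation_wilsonLoop ρ hρ hlim R T).abs
    (hLs.tendsto_atTop.eventually h)

/-- **A torus perimeter law valid on all large tori passes to every limit point**: if for some
`c` and all `R, T ≥ 1` the bound `e^{-c·2(R+T)} ≤ ⟨W_{R×T}⟩_{Λ_{L+1},β}` holds for all large `L`,
then every `μ ∈ infiniteVolumeLimitPoints ρ β` satisfies `HasPerimeterLaw μ (normalisedCharacter N ∘ ρ)`
(Seiler LNP 159 §2 for the notions). [folklore] -/
theorem hasPerimeterLaw_of_eventually [NeZero d] (hρ : Continuous ρ) {β c : ℝ}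
    (h : ∀ R T : ℕ, 1 ≤ R → 1 ≤ T → ∀ᶠ L : ℕ in atTop,
      Real.exp (-c * (2 * (R + T))) ≤ QuantumFieldTheory.wilsonExpectation (L := L + 1) ρ β
        (QuantumFieldTheory.wilsonLoop ρ (0 : QuantumFieldTheory.Site d (L + 1)) 0 1 R T))
    {μ : Measure (LGConfig d G)} (hμ : μ ∈ infiniteVolumeLimitPoints ρ β) :
    HasPerimeterLaw μ (fun g => normalisedCharacter N (ρ g)) :=
  ⟨c, fun R T hR hT => le_rectExpectation_of_eventually ρ hρ hμ (h R T hR hT)⟩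

/-- **Discharge of `hasAreaLawState_of_hasAreaLaw`.** Wave 0's volume-uniform torus area law
`|⟨W_{R×T}⟩_{Λ_L,β}| ≤ C^{2(R+T)} e^{-cRT}` (`1 ≤ R, T ≤ L/2`, all `L`) holds, for fixed `R, T ≥ 1`,
on all tori `Λ_{L+1}` with `L + 1 ≥ 2 max(R,T)`, hence eventually in `L`; the bound is closed and
passes to every infinite-volume limit point (`abs_rectExpectation_le_of_eventually`). Requires
`2 ≤ d` only to have `(0 : Fin d) ≠ 1`. [folklore] -/
theorem hasAreaLawState_of_hasAreaLaw_holds : hasAreaLawState_of_hasAreaLaw (d := d) ρ := by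
  intro _ _ _ _ hd hρ β h μ hμ
  obtain ⟨C, c, hc, hA⟩ := h
  refine ⟨C, c, hc, fun R T hR hT => ?_⟩
  have h01 : (0 : Fin d) ≠ 1 := by
    intro h01
    have := congrArg Fin.val h01
    rw [Fin.val_zero, Fin.val_one', Nat.one_mod_eq_one.mpr (by omega)] at this
    exact zero_ne_one this
  have hev : ∀ᶠ L : ℕ in atTop, |QuantumFieldTheory.wilsonExpectation (L := L + 1) ρ β
      (QuantumFieldTheory.wilsonLoop ρ (0 : QuantumFieldTheory.Site d (L + 1)) 0 1 R T)|
        ≤ C ^ (2 * (R + T)) * Real.exp (-c * R * T) := by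
    filter_upwards [eventually_ge_atTop (2 * R + 2 * T)] with L hL
    have h' := hA (L + 1) 0 0 1 R T h01 hR hT (by omega) (by omega)
    rwa [mul_assoc] 
  exact abs_rectExpectation_le_of_eventually ρ hρ hμ hev

end Limits

end Literature.MathematicalPhysics.QuantumLattice
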